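import Summits.AtomisticToContinuum.FouriersLaw.Theses.ContactEchoEpochs

/-!
# Birth skeleton — crux `DarkTime` (stmt-AtomisticToContinuum-11821)

Route `route-AtomisticToContinuum-ContactEchoEpochs`, sub-problem `FouriersLaw`, crux rank 4 (W1, the
DARK-TIME window): for `P = pinnedChain ω₂ lam β γ` (all `> 0`), `T > 0`, `N = n + 2`, Gibbs state
`μ_T = P.gibbsMeasure N T`, constructed kernels `P_t = P.transitionKernel N T T t`, contact powers
`w_L = γ(T − p_0²)`, `w_R = γ(T − p_{N−1}²)` and contact echo `c_N(t) = ∫ w_L · (P_t w_R) dμ_T`: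
`∃ v > 0, (N−1) T⁻² ∫_{[0, N/v]} |c_N(t)| dt → 0` (no echo mass before the signal can arrive).

BC3 skeleton (skeleton-register, planner one-shot 2026-08-17): TWO named stubs and the kernel-checked
composition `DarkTime_of` concluding the crux BY NAME; the real-analysis glue
(`tendsto_darkWindow_of_coneBound`: a light-cone envelope on `[0, N/v₀]` forces the normalised echo mass on
the half window `[0, N/(2v₀)]` to vanish — exponentials beat powers) is PROVED here, so the only `sorry`s
are the two stubs.

The line is the route's own foreseen layer-2 child `CovarianceLiebRobinson → W1`, cut at its one genuine
seam — the Gibbs product structure at the LEFT contact versus the dynamics' finite signal velocity towards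
the RIGHT contact:

* `stub_contactDecoupling` (statics at the contact; size M–L, provable with tree tools): under `μ_T` the
  contact momentum `p_0` is an `𝒩(0,T)` variable INDEPENDENT of all other coordinates and `E w_L = 0`, so
  for `g_t := P_t w_R` and its `p_0`-resampling `(A₀ g_t)(z) := ∫ g_t(q, p[0 ↦ s]) d𝒩(0,T)(s)` one has
  `c_N(t) = ∫ w_L (g_t − A₀ g_t) dμ_T`, hence (Cauchy–Schwarz, `‖w_L‖_{L²(μ_T)} = √2 γ T`)
  `|c_N(t)| ≤ K ‖g_t − A₀ g_t‖_{L²(μ_T)}` with `K = √2 γ T` (stated `∃ K ≥ 0`). Needs `g_t ∈ L²(μ_T)`: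
  Jensen for the Markov kernel + Gibbs invariance of the constructed kernels at `T_L = T_R = T`
  (tree: `pinnedChain_gibbsMeasure_bind_transitionKernel`) + Gaussian fourth moments
  (tree: `pinnedChain_integral_sq_momentum_gibbsMeasure`, `…_indep_sq_momentum_mul_gibbsDensity`,
  `OscillatorChain.map_snd_eq_gaussianReal`).
* `stub_sensitivityLightCone` (LOAD-BEARING, open; the Lieb–Robinson content in the form classical
  finite-speed bounds are actually proved — growth of the dependence on far-away initial data in Gibbs mean,
  MarchioroPellegrinottiPulvirenti1978 / ButtaEtAl2007 / RazSims2009): the `L²(μ_T)` sensitivity of the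
  evolved right-contact power to resampling the left-contact momentum is exponentially small outside a
  LINEAR cone, `‖P_t w_R − A₀ P_t w_R‖_{L²(μ_T)} ≤ C N^k (1+t)^m e^{−c(N − v₀ t)}` for `0 ≤ t ≤ N/v₀`
  (polynomial prefactors in `N` and `t` allowed; `C, c, v₀ > 0`, `k, m ∈ ℕ` depend on the parameters and
  `T` only). This is exactly where the route's "why it might fail" bites (sup-norm LR is false for quartic
  forces; printed Gibbs-averaged regions are `t log^α t`, not cones; fast energetic carriers must be
  scattered by the thermal bulk) — isolated from the statics and from the bookkeeping.
* `DarkTime_of : Sig.stub_contactDecoupling → Sig.stub_sensitivityLightCone → DarkTime` (no sorry):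
  multiply the two bounds into the covariance light-cone bound `|c_N(t)| ≤ (K C) N^k (1+t)^m e^{−c(N−v₀t)}`
  on `[0, N/v₀]`, take `v := 2 v₀`, and apply the proved glue: on `[0, N/(2v₀)]` the envelope is
  `≤ (K C)(1 + 1/(2v₀))^m N^{k+m} e^{−cN/2}`, so `(N−1) T⁻² ∫_{[0,N/(2v₀)]} |c_N| ≤ D · N^{k+m+2} e^{−cN/2} → 0`
  (`norm_setIntegral_le_of_norm_le_const`, `tendsto_rpow_mul_exp_neg_mul_atTop_nhds_zero`, squeeze).

File map: §1 `Sig.stub_<name> : Prop` — the two stub STATEMENTS (named, so that the composition's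
hypotheses are the declared stubs BY NAME); §2 `theorem stub_<name> : <statement verbatim> := by sorry` —
the registered stubs (the ONLY sorries); §3 the proved real-analysis glue; §4 `DarkTime_of` — the
composition, the unique declaration concluding the crux; §5 an `example` instantiating it through the
sorried stubs.

Disproof used: none — no `Disproof.lean` / Negative lemma is filed on this crux (`ledger crux ls
stmt-AtomisticToContinuum-11821`: no workfiles, 2026-08-17). Negatives index (20 refuted statements of the
summit, 2 on FouriersLaw): `not_OddCorrectorDecay` (N-UNIFORM `L¹_t` decay of the momentum-odd sector of the
TOTAL current — neither stub asks a uniform-in-time or N-uniform decay: stub 2 is a bound on a FIXED window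
`t ≤ N/v₀` with polynomial slack, stub 1 is an inequality at each fixed `(N, t)`) and
`DiluteCellGaussianiserFarFieldGaussianity_refuted` (another model) — no stub is an instance of either.
-/

namespace Summit.AtomisticToContinuum.FouriersLaw.Cruxes.DarkTime.Birth

open MeasureTheory Filter Set Topology
open Literature.MathematicalPhysics.KineticTheory.HeatConduction
open Summit.AtomisticToContinuum.FouriersLaw.Theses.ContactEchoEpochs (DarkTime)

/-! ## §1 The stub statements (named)

Notation of the docstrings (everything is INLINED in the statements, exactly as in the route file):
`P = pinnedChain ω₂ lam β γ`, `N = n + 2`, `μ_T = P.gibbsMeasure (n+2) T`,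
`P_t = P.transitionKernel (n+2) T T t.toNNReal`, `w_R(y) = γ (T − (y.2 (Fin.last (n+1)))²)`,
`g_t(z) = ∫ w_R dP_t(z, ·)` (`= P_t w_R`), `(A₀ g_t)(z) = ∫ g_t (z.1, z.2[0 ↦ s]) d(gaussianReal 0 T)(s)`
(resampling of the left-contact momentum from its Gibbs conditional law `𝒩(0,T)`),
`c_N(t) = ∫ γ (T − (z.2 0)²) · g_t(z) dμ_T(z)` (the contact echo of the crux, verbatim). -/

/-- Statement of `stub_contactDecoupling`: `∃ K ≥ 0, ∀ N ≥ 2, ∀ t ≥ 0,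
|c_N(t)| ≤ K · ‖g_t − A₀ g_t‖_{L²(μ_T)}` (with `K = √2 γ T`). -/
def Sig.stub_contactDecoupling : Prop :=
  ∀ ω₂ lam β γ : ℝ, 0 < ω₂ → 0 < lam → 0 < β → 0 < γ → ∀ T : ℝ, 0 < T →
    ∃ K : ℝ, 0 ≤ K ∧ ∀ (n : ℕ) (t : ℝ), 0 ≤ t →
      |(∫ z, γ * (T - (z.2 0) ^ 2) *
          (∫ y, γ * (T - (y.2 (Fin.last (n + 1))) ^ 2)
            ∂((pinnedChain ω₂ lam β γ).transitionKernel (n + 2) T T (Real.toNNReal t) z))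
        ∂((pinnedChain ω₂ lam β γ).gibbsMeasure (n + 2) T))|
      ≤ K * Real.sqrt (∫ z,
          ((∫ y, γ * (T - (y.2 (Fin.last (n + 1))) ^ 2)
              ∂((pinnedChain ω₂ lam β γ).transitionKernel (n + 2) T T (Real.toNNReal t) z))
            - ∫ s, (∫ y, γ * (T - (y.2 (Fin.last (n + 1))) ^ 2)
                ∂((pinnedChain ω₂ lam β γ).transitionKernel (n + 2) T T (Real.toNNReal t)
                  (z.1, Function.update z.2 0 s)))
              ∂(ProbabilityTheory.gaussianReal 0 (Real.toNNReal T))) ^ 2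
          ∂((pinnedChain ω₂ lam β γ).gibbsMeasure (n + 2) T))

/-- Statement of `stub_sensitivityLightCone` (LOAD-BEARING): `∃ C c v₀ > 0, k m ∈ ℕ, ∀ N ≥ 2,
∀ t ∈ [0, N/v₀], ‖g_t − A₀ g_t‖_{L²(μ_T)} ≤ C N^k (1+t)^m e^{−c (N − v₀ t)}`. -/
def Sig.stub_sensitivityLightCone : Prop :=
  ∀ ω₂ lam β γ : ℝ, 0 < ω₂ → 0 < lam → 0 < β → 0 < γ → ∀ T : ℝ, 0 < T →
    ∃ (C c v₀ : ℝ) (k m : ℕ), 0 < C ∧ 0 < c ∧ 0 < v₀ ∧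
      ∀ (n : ℕ) (t : ℝ), 0 ≤ t → t ≤ ((n : ℝ) + 2) / v₀ →
        Real.sqrt (∫ z,
          ((∫ y, γ * (T - (y.2 (Fin.last (n + 1))) ^ 2)
              ∂((pinnedChain ω₂ lam β γ).transitionKernel (n + 2) T T (Real.toNNReal t) z))
            - ∫ s, (∫ y, γ * (T - (y.2 (Fin.last (n + 1))) ^ 2)
                ∂((pinnedChain ω₂ lam β γ).transitionKernel (n + 2) T T (Real.toNNReal t)
                  (z.1, Function.update z.2 0 s)))
              ∂(ProbabilityTheory.gaussianReal 0 (Real.toNNReal T))) ^ 2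
          ∂((pinnedChain ω₂ lam β γ).gibbsMeasure (n + 2) T))
        ≤ C * ((n : ℝ) + 2) ^ k * (1 + t) ^ m * Real.exp (-(c * (((n : ℝ) + 2) - v₀ * t)))

/-! ## §2 The registered stubs (the only `sorry`s of the file) -/

/-- STUB 1 `stub_contactDecoupling` (statics at the left contact; size M–L). For all parameters `> 0`,
`T > 0`: there is `K ≥ 0` (namely `K = ‖w_L‖_{L²(μ_T)} = √2 γ T`) such that for every `N = n+2` and
`t ≥ 0`, `|c_N(t)| ≤ K ‖P_t w_R − A₀ P_t w_R‖_{L²(μ_T)}`. Mechanism: `μ_T = (⊗ 𝒩(0,T) on momenta) ⊗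
(position Gibbs measure)`, so `p_0` is independent of every other coordinate; `A₀ P_t w_R` does not depend on
`p_0` and `E_{μ_T} w_L = γ(T − E p_0²) = 0`, whence `∫ w_L · A₀ P_t w_R dμ_T = 0`,
`c_N(t) = ⟨w_L, (1 − A₀) P_t w_R⟩_{μ_T}` and Cauchy–Schwarz. Square-integrability of `P_t w_R`: Jensen for
the Markov kernel `P_t(z, ·)` and Gibbs invariance `μ_T P_t = μ_T` at equal bath temperatures.
[BonettoLebowitzReyBellet2000 §4.1 (Gibbs state); CuneoEckmannHairerReyBellet2018 §3.1; tree: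
`pinnedChain_gibbsMeasure_bind_transitionKernel`, `OscillatorChain.map_snd_eq_gaussianReal`,
`pinnedChain_integral_indep_sq_momentum_mul_gibbsDensity`] -/
theorem stub_contactDecoupling :
  ∀ ω₂ lam β γ : ℝ, 0 < ω₂ → 0 < lam → 0 < β → 0 < γ → ∀ T : ℝ, 0 < T →
    ∃ K : ℝ, 0 ≤ K ∧ ∀ (n : ℕ) (t : ℝ), 0 ≤ t →
      |(∫ z, γ * (T - (z.2 0) ^ 2) *
          (∫ y, γ * (T - (y.2 (Fin.last (n + 1))) ^ 2)
            ∂((pinnedChain ω₂ lam β γ).transitionKernel (n + 2) T T (Real.toNNReal t) z))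
        ∂((pinnedChain ω₂ lam β γ).gibbsMeasure (n + 2) T))|
      ≤ K * Real.sqrt (∫ z,
          ((∫ y, γ * (T - (y.2 (Fin.last (n + 1))) ^ 2)
              ∂((pinnedChain ω₂ lam β γ).transitionKernel (n + 2) T T (Real.toNNReal t) z))
            - ∫ s, (∫ y, γ * (T - (y.2 (Fin.last (n + 1))) ^ 2)
                ∂((pinnedChain ω₂ lam β γ).transitionKernel (n + 2) T T (Real.toNNReal t)
                  (z.1, Function.update z.2 0 s)))
              ∂(ProbabilityTheory.gaussianReal 0 (Real.toNNReal T))) ^ 2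
          ∂((pinnedChain ω₂ lam β γ).gibbsMeasure (n + 2) T)) := by
  sorry

/-- STUB 2 `stub_sensitivityLightCone` (LOAD-BEARING; open; size L–XL). For all parameters `> 0`, `T > 0`:
there are `C, c, v₀ > 0` and `k, m ∈ ℕ` such that for every `N = n+2` and `0 ≤ t ≤ N/v₀`,
`‖P_t w_R − A₀ P_t w_R‖_{L²(μ_T)} ≤ C N^k (1+t)^m exp(−c (N − v₀ t))` — in Gibbs mean square, the evolved
right-contact power does not feel the left-contact momentum before the light cone `t = N/v₀` reaches it, up
to an exponentially small leak. A classical Lieb–Robinson / finite-group-velocity bound for the THERMAL pinned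
anharmonic chain with Langevin contacts, in `L²(μ_T)`-sensitivity form (tangent dynamics
`∂Z_t(N−1)/∂p_0(0)` = sum over lattice paths of length `≥ N−1`, controlled in Gibbs mean; the baths act on
`p_0, p_{N−1}` only and are contractive). Why it might fail: amplitude-dependent speed `∼ (βE)^{1/4}` of the
quartic coupling — a LINEAR cone with a FIXED rate `c` needs the fast energetic carriers to be exponentially
rare AND scattered by the thermal background; printed Gibbs-averaged bounds give regions `t log^α t`.
[MarchioroPellegrinottiPulvirenti1978; ButtaEtAl2007 Thm 2.2; RazSims2009; NachtergaeleEtAl2008 Thm 4.1;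
doi:10.4064/cm118-2-17] -/
theorem stub_sensitivityLightCone :
  ∀ ω₂ lam β γ : ℝ, 0 < ω₂ → 0 < lam → 0 < β → 0 < γ → ∀ T : ℝ, 0 < T →
    ∃ (C c v₀ : ℝ) (k m : ℕ), 0 < C ∧ 0 < c ∧ 0 < v₀ ∧
      ∀ (n : ℕ) (t : ℝ), 0 ≤ t → t ≤ ((n : ℝ) + 2) / v₀ →
        Real.sqrt (∫ z,
          ((∫ y, γ * (T - (y.2 (Fin.last (n + 1))) ^ 2)
              ∂((pinnedChain ω₂ lam β γ).transitionKernel (n + 2) T T (Real.toNNReal t) z))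
            - ∫ s, (∫ y, γ * (T - (y.2 (Fin.last (n + 1))) ^ 2)
                ∂((pinnedChain ω₂ lam β γ).transitionKernel (n + 2) T T (Real.toNNReal t)
                  (z.1, Function.update z.2 0 s)))
              ∂(ProbabilityTheory.gaussianReal 0 (Real.toNNReal T))) ^ 2
          ∂((pinnedChain ω₂ lam β γ).gibbsMeasure (n + 2) T))
        ≤ C * ((n : ℝ) + 2) ^ k * (1 + t) ^ m * Real.exp (-(c * (((n : ℝ) + 2) - v₀ * t))) := by
  sorry

/-! ## §3 The glue (real analysis, fully proved) -/

/-- GLUE (proved). If a family `f n : ℝ → ℝ` obeys a light-cone envelope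
`|f n t| ≤ C (n+2)^k (1+t)^m e^{−c((n+2) − v₀ t)}` for `0 ≤ t ≤ (n+2)/v₀` (`C ≥ 0`, `c, v₀ > 0`), then the
normalised mass on the HALF window vanishes: `((n+1)/T²) ∫_{[0,(n+2)/(2v₀)]} |f n t| dt → 0`.
Proof: on the half window `(n+2) − v₀ t ≥ (n+2)/2` and `1 + t ≤ (1 + 1/(2v₀))(n+2)`, so the integrand is
bounded by `C (1+1/(2v₀))^m (n+2)^{k+m} e^{−c(n+2)/2}`; integrate over a window of length `(n+2)/(2v₀)`
(`norm_setIntegral_le_of_norm_le_const`, true with Bochner junk values), multiply by `(n+1)/T² ≤ (n+2)/T²`,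
and squeeze against `D (n+2)^{k+m+2} e^{−(c/2)(n+2)} → 0` (`tendsto_rpow_mul_exp_neg_mul_atTop_nhds_zero`). -/
theorem tendsto_darkWindow_of_coneBound (f : ℕ → ℝ → ℝ) (T : ℝ) {C c v₀ : ℝ} {k m : ℕ}
    (hC : 0 ≤ C) (hc : 0 < c) (hv₀ : 0 < v₀)
    (hf : ∀ (n : ℕ) (t : ℝ), 0 ≤ t → t ≤ ((n : ℝ) + 2) / v₀ →
      |f n t| ≤ C * ((n : ℝ) + 2) ^ k * (1 + t) ^ m * Real.exp (-(c * (((n : ℝ) + 2) - v₀ * t)))) :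
    Tendsto (fun n : ℕ => ((n : ℝ) + 1) / T ^ 2 *
      ∫ t in Set.Icc 0 (((n : ℝ) + 2) / (2 * v₀)), |f n t|) atTop (𝓝 0) := by
  have hv2 : (0 : ℝ) < 2 * v₀ := by positivity
  -- the comparison sequence `D · (N^(k+m+2) e^{-(c/2) N})`, `N = n + 2`
  have hlim : Tendsto (fun n : ℕ => C * (1 + 1 / (2 * v₀)) ^ m / (2 * v₀) / T ^ 2 *
      (((n : ℝ) + 2) ^ (k + m + 2) * Real.exp (-(c / 2) * ((n : ℝ) + 2)))) atTop (𝓝 0) := by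
    have h1 : Tendsto (fun x : ℝ => x ^ (k + m + 2) * Real.exp (-(c / 2) * x)) atTop (𝓝 0) := by
      refine (tendsto_rpow_mul_exp_neg_mul_atTop_nhds_zero ((k + m + 2 : ℕ) : ℝ) (c / 2)
        (by positivity)).congr' (Eventually.of_forall fun x => ?_)
      simp only [Real.rpow_natCast]
    have h2 := h1.comp (tendsto_atTop_add_const_right atTop (2 : ℝ) tendsto_natCast_atTop_atTop)
    have h3 := h2.const_mul (C * (1 + 1 / (2 * v₀)) ^ m / (2 * v₀) / T ^ 2)
    rw [mul_zero] at h3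
    exact h3
  refine tendsto_of_tendsto_of_tendsto_of_le_of_le tendsto_const_nhds hlim (fun n => ?_) (fun n => ?_)
  · -- lower bound: the window mass is non-negative
    dsimp only
    exact mul_nonneg (by positivity) (setIntegral_nonneg measurableSet_Icc fun t _ => abs_nonneg _)
  · -- upper bound
    dsimp only
    have hN1 : (1 : ℝ) ≤ (n : ℝ) + 2 := by
      have := Nat.cast_nonneg (α := ℝ) n
      linarith
    have hN0 : (0 : ℝ) ≤ (n : ℝ) + 2 := by positivity
    have hL0 : (0 : ℝ) ≤ ((n : ℝ) + 2) / (2 * v₀) := by positivity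
    -- pointwise envelope on the half window
    have hpt : ∀ t ∈ Set.Icc (0 : ℝ) (((n : ℝ) + 2) / (2 * v₀)),
        ‖|f n t|‖ ≤ C * ((n : ℝ) + 2) ^ k * ((1 + 1 / (2 * v₀)) ^ m * ((n : ℝ) + 2) ^ m) *
          Real.exp (-(c / 2) * ((n : ℝ) + 2)) := by
      intro t ht
      obtain ⟨ht0, ht1⟩ := ht
      have ht1' : t ≤ ((n : ℝ) + 2) / v₀ :=
        ht1.trans (div_le_div_of_nonneg_left hN0 hv₀ (by linarith))
      have h1 := hf n t ht0 ht1'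
      rw [Real.norm_eq_abs, abs_abs]
      have ht1c := ht1
      rw [le_div_iff₀ hv2] at ht1c
      have h2 : v₀ * t ≤ ((n : ℝ) + 2) / 2 := by linarith
      have h3 : Real.exp (-(c * (((n : ℝ) + 2) - v₀ * t))) ≤
          Real.exp (-(c / 2) * ((n : ℝ) + 2)) := by
        rw [Real.exp_le_exp]
        have := mul_le_mul_of_nonneg_left h2 hc.le
        linarith
      have h4 : (1 + t) ^ m ≤ (1 + 1 / (2 * v₀)) ^ m * ((n : ℝ) + 2) ^ m := by
        rw [← mul_pow]
        apply pow_le_pow_left₀ (by linarith)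
        have h5 : (1 + 1 / (2 * v₀)) * ((n : ℝ) + 2) =
            ((n : ℝ) + 2) + ((n : ℝ) + 2) / (2 * v₀) := by ring
        rw [h5]
        linarith
      have h6 : C * ((n : ℝ) + 2) ^ k * (1 + t) ^ m * Real.exp (-(c * (((n : ℝ) + 2) - v₀ * t))) ≤
          C * ((n : ℝ) + 2) ^ k * ((1 + 1 / (2 * v₀)) ^ m * ((n : ℝ) + 2) ^ m) *
            Real.exp (-(c / 2) * ((n : ℝ) + 2)) := by
        apply mul_le_mul _ h3 (Real.exp_pos _).le (by positivity)
        exact mul_le_mul_of_nonneg_left h4 (by positivity)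
      exact h1.trans h6
    -- integrate the envelope over the half window (length `(n+2)/(2v₀)`)
    have hint := norm_setIntegral_le_of_norm_le_const (μ := volume) measure_Icc_lt_top hpt
    rw [Real.volume_real_Icc_of_le hL0, sub_zero] at hint
    have habs : |(∫ t in Set.Icc 0 (((n : ℝ) + 2) / (2 * v₀)), |f n t|)|
        ≤ C * ((n : ℝ) + 2) ^ k * ((1 + 1 / (2 * v₀)) ^ m * ((n : ℝ) + 2) ^ m) *
          Real.exp (-(c / 2) * ((n : ℝ) + 2)) * (((n : ℝ) + 2) / (2 * v₀)) := by
      simpa only [Real.norm_eq_abs] using hint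
    have hint' := (le_abs_self _).trans habs
    calc ((n : ℝ) + 1) / T ^ 2 * ∫ t in Set.Icc 0 (((n : ℝ) + 2) / (2 * v₀)), |f n t|
        ≤ ((n : ℝ) + 1) / T ^ 2 * (C * ((n : ℝ) + 2) ^ k * ((1 + 1 / (2 * v₀)) ^ m * ((n : ℝ) + 2) ^ m) *
          Real.exp (-(c / 2) * ((n : ℝ) + 2)) * (((n : ℝ) + 2) / (2 * v₀))) :=
          mul_le_mul_of_nonneg_left hint' (by positivity)
      _ ≤ ((n : ℝ) + 2) / T ^ 2 * (C * ((n : ℝ) + 2) ^ k * ((1 + 1 / (2 * v₀)) ^ m * ((n : ℝ) + 2) ^ m) *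
          Real.exp (-(c / 2) * ((n : ℝ) + 2)) * (((n : ℝ) + 2) / (2 * v₀))) :=
          mul_le_mul_of_nonneg_right (div_le_div_of_nonneg_right (by linarith) (sq_nonneg T))
            (by positivity)
      _ = C * (1 + 1 / (2 * v₀)) ^ m / (2 * v₀) / T ^ 2 *
          (((n : ℝ) + 2) ^ (k + m + 2) * Real.exp (-(c / 2) * ((n : ℝ) + 2))) := by ring

/-! ## §4 The composition -/

/-- COMPOSITION (kernel-checked, no sorry): the two stubs, BY NAME, give the crux
`Summit.AtomisticToContinuum.FouriersLaw.Theses.ContactEchoEpochs.DarkTime`.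
Proof: contact decoupling × sensitivity light cone = the covariance light-cone bound
`|c_N(t)| ≤ (K C) N^k (1+t)^m e^{−c(N − v₀t)}` on `[0, N/v₀]`; take `v := 2 v₀` and apply the glue
`tendsto_darkWindow_of_coneBound` to `f n t := c_{n+2}(t)`. -/
theorem DarkTime_of :
    Sig.stub_contactDecoupling → Sig.stub_sensitivityLightCone → DarkTime := by
  intro h1 h2 ω₂ lam β γ hω hl hβ hγ T hT
  obtain ⟨K, hK, hdec⟩ := h1 ω₂ lam β γ hω hl hβ hγ T hT
  obtain ⟨C, c, v₀, k, m, hC, hc, hv₀, hcone⟩ := h2 ω₂ lam β γ hω hl hβ hγ T hT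
  refine ⟨2 * v₀, by positivity, ?_⟩
  refine tendsto_darkWindow_of_coneBound _ T (C := K * C) (k := k) (m := m)
    (mul_nonneg hK hC.le) hc hv₀ ?_
  intro n t ht0 ht1
  have hA := hdec n t ht0
  have hB := mul_le_mul_of_nonneg_left (hcone n t ht0 ht1) hK
  have hEq : K * (C * ((n : ℝ) + 2) ^ k * (1 + t) ^ m * Real.exp (-(c * (((n : ℝ) + 2) - v₀ * t))))
      = K * C * ((n : ℝ) + 2) ^ k * (1 + t) ^ m * Real.exp (-(c * (((n : ℝ) + 2) - v₀ * t))) := by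
    ring
  exact hA.trans (hB.trans hEq.le)

/-! ## §5 Instantiation through the sorried stubs (an `example`: registers nothing and leaves
`DarkTime_of` the unique declaration concluding the crux) -/

example : DarkTime := DarkTime_of stub_contactDecoupling stub_sensitivityLightCone

end Summit.AtomisticToContinuum.FouriersLaw.Cruxes.DarkTime.Birth
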